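import Literature.Computability.Cryptography.HallgrenWalkOpsK
import Literature.Computability.Cryptography.HallgrenCycleInstance
import HarnessLib

/-!
# The principal cycle with Hallgren's computed giant step, as a `GiantStepCycle` over integer labels

Topic `Computability/Cryptography`; joins `HallgrenWalkOpsK.lean` (`hallgrenOps`, the integer walk
operations, with the clamped defect evaluator `kIntG` and the gap evaluator `gIntG`) to
`HallgrenCycleInstance.lean` (the principal cycle unrolled over `ℤ`: `labZ`, `posZ`) and
`HallgrenGiantStep*.lean` (the giant step lands on the cycle with correction `kappaQ`, `|κ| ≤ K(D)`,
evaluated to `(4 size D + 27)/2ᵖ`). Result: for a good discriminant `D` and a precision `p` with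
`2ᵖ ≥ 8(4 size D + 29)`, a `GiantStepCycle (ℤ × ℤ)` whose walk data IS `hallgrenOps.toWalkData (D, p)`
— so the generic navigation/verification theorems (`InfrastructureNavigation`, `HallgrenCandidateCheck`,
`passesI_eq`) apply to the integer programs. Theorem-and-definition file, no named facts.

## References

* R. Jozsa, arXiv:quant-ph/0302134 (2003), §7–§9 (Thm. 5). [Jozsa2003]
* M. J. Jacobson, Jr., H. C. Williams, *Solving the Pell Equation*, Springer (2009), §7.4. [JacobsonWilliams2008]
-/

noncomputable section

open scoped Classical

namespace Literature.Computability.Cryptography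

namespace HallgrenGiantStep

open Literature.NumberTheory.QuadraticFields Literature.NumberTheory.QuadraticFields.QuadIrr HallgrenComposition
  InfraPrimitives PrincipalCycle

variable {D : ℕ} (hD : ¬ IsSquare D) (hD4 : D % 4 = 0 ∨ D % 4 = 1)

/-- Integer labels of elements of the principal cycle. [folklore] -/
def IsCyc (D : ℕ) (a : ℤ × ℤ) : Prop := ∃ i : ℕ, a = pr (step^[i] (principalFirst D))

omit hD hD4 in
/-- `qi (pr x) = x`. [folklore] -/
@[simp] theorem qi_pr (x : QuadIrr D) : qi D (pr x) = x := by cases x; rfl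

/-- The precision of the evaluators: `η = (4 size D + 29)/2ᵖ`. [cite: Jozsa2003, §9 Thm. 5] -/
def etaOf (D p : ℕ) : ℝ := (4 * D.size + 29) / (2 : ℝ) ^ p

/-- **The true defect**: `κ` on cycle labels, the computed value elsewhere (so that the evaluator is
exact off the cycle, where nothing is claimed). [cite: Jozsa2003, §7.2] -/
def kappaZ (D p : ℕ) (a b : ℤ × ℤ) : ℝ :=
  if IsCyc D a ∧ IsCyc D b then kappaQ (qi D a) (qi D b) else (kIntG (D, p) a b : ℝ) / 2 ^ p

include hD hD4

/-- On cycle labels the computed defect is within `(4 size D + 27)/2ᵖ` and unclamped. [cite: Jozsa2003, §9 Thm. 5] -/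
theorem kIntG_cyc (p i j : ℕ) (hp : 8 * (4 * D.size + 29) ≤ 2 ^ p) :
    kIntG (D, p) (pr (step^[i] (principalFirst D))) (pr (step^[j] (principalFirst D))) =
      kappaG (D, p) (pr (step^[i] (principalFirst D))) (pr (step^[j] (principalFirst D))) ∧
    |kappaQ (step^[i] (principalFirst D)) (step^[j] (principalFirst D)) -
        (kIntG (D, p) (pr (step^[i] (principalFirst D))) (pr (step^[j] (principalFirst D))) : ℝ) / 2 ^ p| ≤
      (4 * D.size + 27) / (2 : ℝ) ^ p := by
  have hacc := abs_kappaQ_sub_kappaG_le hD hD4 i j p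
  have hK := abs_kappaQ_le hD hD4 i j
  have h2p : (0 : ℝ) < (2 : ℝ) ^ p := by positivity
  have hsmall : (4 * D.size + 27 : ℝ) / (2 : ℝ) ^ p ≤ 1 := by
    rw [div_le_one h2p]
    have : ((8 * (4 * D.size + 29) : ℕ) : ℝ) ≤ ((2 ^ p : ℕ) : ℝ) := by exact_mod_cast hp
    push_cast at this; linarith
  have hclamp : |kappaG (D, p) (pr (step^[i] (principalFirst D))) (pr (step^[j] (principalFirst D)))| ≤ KIntG (D, p) := by
    -- `|kappaG/2ᵖ| ≤ KQ + 1`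
    have h1 : |(kappaG (D, p) (pr (step^[i] (principalFirst D))) (pr (step^[j] (principalFirst D))) : ℝ) / 2 ^ p| ≤ KQ D + 1 := by
      have := abs_sub_abs_le_abs_sub (kappaQ (step^[i] (principalFirst D)) (step^[j] (principalFirst D)))
        ((kappaG (D, p) (pr (step^[i] (principalFirst D))) (pr (step^[j] (principalFirst D))) : ℝ) / 2 ^ p)
      rw [abs_sub_comm] at this
      have := abs_sub_abs_le_abs_sub ((kappaG (D, p) (pr (step^[i] (principalFirst D))) (pr (step^[j] (principalFirst D))) : ℝ) / 2 ^ p)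
        (kappaQ (step^[i] (principalFirst D)) (step^[j] (principalFirst D)))
      rw [abs_sub_comm] at this
      linarith
    have h2 : |(kappaG (D, p) (pr (step^[i] (principalFirst D))) (pr (step^[j] (principalFirst D))) : ℝ)| ≤ (KQ D + 1) * 2 ^ p := by
      rw [abs_div, abs_of_pos h2p, div_le_iff₀ h2p] at h1; exact h1
    have h3 : ((KIntG (D, p) : ℕ) : ℝ) = (KQ D + 1) * 2 ^ p := by
      have e : ((KQn D : ℕ) : ℝ) = ((KQ D : ℚ) : ℝ) := by rw [← KQn_eq]; norm_cast
      unfold KIntG; push_cast; rw [e]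
    have : ((|kappaG (D, p) (pr (step^[i] (principalFirst D))) (pr (step^[j] (principalFirst D)))| : ℤ) : ℝ) ≤ ((KIntG (D, p) : ℕ) : ℤ) := by
      push_cast; rw [h3]; simpa using h2
    exact_mod_cast this
  have heq := kIntG_eq_of_abs_le (d := (D, p)) ⟨hD, hD4⟩ hclamp
  refine ⟨heq, ?_⟩
  rw [heq]; exact hacc

/-- **Hallgren's walk data on a good discriminant form a `GiantStepCycle` over integer labels.**
Unit `pr x₁`, labels `pr ∘ labZ`, positions `posZ`, `R = log ε`, `n = p`, `G = log(2√D)`, `L = log 2`,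
defect `kappaZ`, precision `η = (4 size D + 29)/2ᵖ ≤ 1/8`.
[cite: Jozsa2003, §7–§9] [cite: JacobsonWilliams2008, §7.4] -/
def hallgrenCycle (p : ℕ) (hp : 8 * (4 * D.size + 29) ≤ 2 ^ p) : GiantStepCycle (ℤ × ℤ) where
  toWalkData := hallgrenOps.toWalkData (D, p)
  R := Real.log (fundUnit D)
  n := periodLength D
  P := posZ D
  lab m := pr (labZ D m)
  kappa := kappaZ D p
  η := etaOf D p
  G := Real.log (2 * Real.sqrt D)
  L := Real.log 2
  n_pos := periodLength_pos hD hD4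
  strictMono := posZ_strictMono hD hD4
  P_zero := posZ_zero hD hD4
  lab_zero := by
    show pr (labZ D 0) = unitG D
    rw [labZ_zero, unitG_eq ⟨hD, hD4⟩]
  periodic := posZ_add_periodLength hD hD4
  lab_eq_iff m m' := by
    rw [← labZ_eq_iff hD hD4]
    exact pr_injective.eq_iff
  rho_lab m := by
    show rhoG D (pr (labZ D m)) = pr (labZ D (m + 1))
    have hred : (labZ D m).IsReduced := isReduced_iterate hD (isReduced_principalFirst hD hD4) _
    rw [rhoG_pr ⟨hD, hD4⟩ hred.1, step_labZ hD hD4]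
  star_lab := by
    intro m₁ m₂
    have hp' := periodLength_pos_int hD hD4
    obtain ⟨k, l, hk, hstar, hpos⟩ := exists_pos_starQ hD hD4 (rep D m₁) (rep D m₂)
    set q₁ : ℤ := m₁ / (periodLength D : ℤ)
    set q₂ : ℤ := m₂ / (periodLength D : ℤ)
    refine ⟨(k : ℤ) + (q₁ + q₂ - l) * periodLength D, ?_, ?_⟩
    · -- label
      show pr (labZ D _) = starG D (pr (step^[rep D m₁] (principalFirst D))) (pr (step^[rep D m₂] (principalFirst D)))
      have hl : labZ D ((k : ℤ) + (q₁ + q₂ - l) * periodLength D) = labZ D (k : ℤ) :=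
        (labZ_eq_iff hD hD4 _ _).mpr ⟨q₁ + q₂ - l, by ring⟩
      rw [hl, labZ_natCast, hstar, starG_pr ⟨hD, hD4⟩ (isIdealShaped_cycle hD hD4 _) (isIdealShaped_cycle hD hD4 _)]
      rfl
    · -- position
      have hcyc : IsCyc D (pr (labZ D m₁)) ∧ IsCyc D (pr (labZ D m₂)) := ⟨⟨rep D m₁, rfl⟩, ⟨rep D m₂, rfl⟩⟩
      show posZ D _ = posZ D m₁ + posZ D m₂ + kappaZ D p (pr (labZ D m₁)) (pr (labZ D m₂))
      rw [kappaZ, if_pos hcyc, qi_pr, qi_pr, posZ_add_mul_periodLength hD hD4, posZ_natCast hD hD4, hpos]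
      unfold posZ labZ
      push_cast
      ring
  abs_kappa_le a b := by
    show |kappaZ D p a b| ≤ (((KIntG (D, p) : ℕ) : ℚ) / 2 ^ p : ℚ)
    have e : ((KQn D : ℕ) : ℝ) = ((KQ D : ℚ) : ℝ) := by rw [← KQn_eq]; norm_cast
    have hK : ((((KIntG (D, p) : ℕ) : ℚ) / 2 ^ p : ℚ) : ℝ) = KQ D + 1 := by
      unfold KIntG; push_cast; rw [e]; field_simp
    rw [hK]
    unfold kappaZ
    split_ifs with hc
    · obtain ⟨⟨i, hi⟩, ⟨j, hj⟩⟩ := hc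
      rw [hi, hj, qi_pr, qi_pr]
      exact (abs_kappaQ_le hD hD4 i j).trans (by linarith)
    · have h := abs_kIntG_le (D, p) a b
      have h2p : (0 : ℝ) < (2 : ℝ) ^ p := by positivity
      rw [abs_div, abs_of_pos h2p, div_le_iff₀ h2p]
      have h3 : ((KIntG (D, p) : ℕ) : ℝ) = (KQ D + 1) * 2 ^ p := by unfold KIntG; push_cast; rw [e]
      have : ((|kIntG (D, p) a b| : ℤ) : ℝ) ≤ ((KIntG (D, p) : ℕ) : ℤ) := by exact_mod_cast h
      push_cast at this; rw [h3] at this; simpa using this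
  ghat_spec m := by
    show |((((gIntG (D, p) (pr (labZ D m)) : ℤ) : ℚ) / 2 ^ p : ℚ) : ℝ) - (posZ D (m + 1) - posZ D m)| ≤ etaOf D p
    rw [posZ_succ_sub hD hD4]
    have hred : (labZ D m).IsReduced := isReduced_iterate hD (isReduced_principalFirst hD hD4) _
    have hval : ValidL D (pr (labZ D m)) := (validL_iff ⟨hD, hD4⟩ _).mpr ⟨isIdealShaped_cycle hD hD4 _, hred⟩
    have h := abs_log_val_sub_gIntG_le (p := p) ⟨hD, hD4⟩ hval
    rw [qi_pr] at h
    have hcast : ((((gIntG (D, p) (pr (labZ D m)) : ℤ) : ℚ) / 2 ^ p : ℚ) : ℝ) = (gIntG (D, p) (pr (labZ D m)) : ℝ) / 2 ^ p := by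
      push_cast; rfl
    rw [hcast, abs_sub_comm]
    unfold gap labZ
    refine h.trans ?_
    unfold etaOf
    exact div_le_div_of_nonneg_right (by linarith) (by positivity)
  khat_spec a b := by
    show |((((kIntG (D, p) a b : ℤ) : ℚ) / 2 ^ p : ℚ) : ℝ) - kappaZ D p a b| ≤ etaOf D p
    have hcast : ((((kIntG (D, p) a b : ℤ) : ℚ) / 2 ^ p : ℚ) : ℝ) = (kIntG (D, p) a b : ℝ) / 2 ^ p := by push_cast; rfl
    rw [hcast]
    unfold kappaZ
    split_ifs with hc
    · obtain ⟨⟨i, hi⟩, ⟨j, hj⟩⟩ := hc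
      subst hi; subst hj
      rw [qi_pr, qi_pr, abs_sub_comm]
      refine (kIntG_cyc hD hD4 p i j hp).2.trans ?_
      unfold etaOf
      exact div_le_div_of_nonneg_right (by linarith) (by positivity)
    · rw [sub_self, abs_zero]; unfold etaOf; positivity
  η_nonneg := by unfold etaOf; positivity
  η_le := by
    unfold etaOf
    rw [div_le_iff₀ (by positivity)]
    have : ((8 * (4 * D.size + 29) : ℕ) : ℝ) ≤ ((2 ^ p : ℕ) : ℝ) := by exact_mod_cast hp
    push_cast at this; linarith
  gap_le m := by
    have h := posZ_succ_sub hD hD4 m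
    have := gap_lt hD hD4 (rep D m)
    show posZ D (m + 1) - posZ D m ≤ Real.log (2 * Real.sqrt D)
    linarith
  two_gap m := (log_two_lt_posZ_add_two_sub hD hD4 m).le
  L_gt := by
    show 2 * etaOf D p < Real.log 2
    have hη : etaOf D p ≤ 1 / 8 := by
      unfold etaOf
      rw [div_le_iff₀ (by positivity)]
      have : ((8 * (4 * D.size + 29) : ℕ) : ℝ) ≤ ((2 ^ p : ℕ) : ℝ) := by exact_mod_cast hp
      push_cast at this; linarith
    have h2 := Real.one_sub_inv_le_log_of_pos (by norm_num : (0 : ℝ) < 2)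
    norm_num at h2
    linarith

/-- **The cycle's walk data are Hallgren's integer operations.** [folklore] -/
theorem hallgrenCycle_toWalkData (p : ℕ) (hp : 8 * (4 * D.size + 29) ≤ 2 ^ p) :
    (hallgrenCycle hD hD4 p hp).toWalkData = hallgrenOps.toWalkData (D, p) := rfl

/-- The cycle's circumference is `log ε`. [cite: Jozsa2003, §6.3 Thm. 4(b)] -/
theorem hallgrenCycle_R (p : ℕ) (hp : 8 * (4 * D.size + 29) ≤ 2 ^ p) :
    (hallgrenCycle hD hD4 p hp).R = Real.log (fundUnit D) := rfl

end HallgrenGiantStep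

end Literature.Computability.Cryptography

end
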